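import Summits.Parity.BatemanHorn.Theses.RoughValueTransport
import Summits.Parity.BatemanHorn.Theorems.RoughValueTransportRoughValueLawTypeISumSwap
import Summits.Parity.BatemanHorn.Theorems.RoughValueTransportRoughValueLawOmegaFacts
import Literature.NumberTheory.Sieve.FriableMoebiusRootSum
import Literature.NumberTheory.Sieve.IwaniecFriableLevel
import Literature.NumberTheory.Sieve.AletheiaZomleferFukshanskyGarcia2020Applications
import HarnessLib

/-!
# Route `RoughValueTransport`, crux `RoughValueLaw` (stmt-Parity-11390), line `friable-deep-tail`:
# the lever S4-slice `TypeILevelPushAt (X² + 1)` — the n-wise Type-I law BEYOND `x` for `n² + 1`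

`--supports` file of the checked skeleton
`Summits/Parity/BatemanHorn/Cruxes/RoughValueLaw/Lines/friable_deep_tail.lean`.  The lever of the
line (S4, narrowed in v7 to its landable slice `f = X² + 1`, de-registered in v11 as "blocked on the
unlanded M0–M2 of HANDBACK-friable-deep-tail.md") states: for Buchstab's `ω` (inline predicate)
there is `u₀ > 2` such that for `u ≥ u₀` and `0 < δ ≤ δ₀(u)`,
`typeISum_{X²+1}(u, 1+δ; x) · log x / x → (𝔖/2) · u · ω((1+δ)u/2)`,
where `typeISum` is the level-`x^{1+δ}` Type-I part of the crux's count `Φ_{X²+1}(x, u)` (sifting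
primes `< ⌈x^{2/u}⌉`) and `𝔖 = batemanHornConst ![X²+1]`.  With M0 (c10), M1 (c11: Buchstab's law
for the friable Möbius–root sum, `FriableMoebiusRoot.exists_abs_friableSum_sub_buchstab_le`) and M2
(c12: Iwaniec's level of distribution beyond `x` over friable moduli,
`Iwaniec1978.abs_sum_friable_moebius_rem_le_rpow`, `Literature/NumberTheory/Sieve/IwaniecFriableLevel.lean`,
p158177, resting on `FriableCellFactorisation/Partition/Counting` p156481/p156983/p157016 and
`IwaniecFriableLevelClasses` p157361) in the tree, this file PROVES it (`u₀ = 150`, `δ₀ = 1/600`):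

* `typeISum_X_sq_add_one_eq` — after the landed swap (`stub_typeISumSwap`, k = 1) the Type-I sum is
  `x · G(D, B) + R(x; D, B)` with `G = Σ_{d ≤ D, P⁺(d) < B} μ(d)ρ(d)/d`, `R = Σ μ(d) r(𝒜; d)`;
* `typeILevelPush_X_sq_add_one_of` — the lever from any level-of-distribution statement of M2's shape;
* `typeILevelPush_X_sq_add_one` — the lever, unconditionally.
-/

noncomputable section

open Filter Finset Polynomial
open scoped Topology BigOperators
open Literature.NumberTheory.Sieve
open Literature.NumberTheory.Sieve.Iwaniec1978 (rho rem congrCount rho_eq_polyRootCountMod)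

namespace Summit.Parity.BatemanHorn.Cruxes.RoughValueLaw.FriableDeepTail

/-! ### Sums over `Fin 1`-tuples -/

/-- A sum over `Fin 1`-tuples drawn from `S` is a sum over `S`. [folklore] -/
theorem sum_piFinset_fin_one {M : Type*} [AddCommMonoid M] (S : Finset ℕ) (g : (Fin 1 → ℕ) → M) :
    ∑ d ∈ Fintype.piFinset (fun _ : Fin 1 => S), g d = ∑ m ∈ S, g (fun _ => m) := by
  refine Finset.sum_nbij' (fun d => d 0) (fun m => fun _ => m) ?_ ?_ ?_ ?_ ?_
  · intro d hd
    exact Fintype.mem_piFinset.mp (Finset.mem_coe.mp hd) 0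
  · intro m hm
    exact Finset.mem_coe.mpr (Fintype.mem_piFinset.mpr fun _ => Finset.mem_coe.mp hm)
  · intro d _
    funext i
    rw [Fin.fin_one_eq_zero i]
  · intro m _
    rfl
  · intro d _
    congr 1
    funext i
    rw [Fin.fin_one_eq_zero i]

/-! ### The Type-I sum of `n² + 1` after the swap -/

/-- `(X² + 1)(n) = n² + 1`. [folklore] -/
theorem eval_X_sq_add_one (n : ℤ) : (X ^ 2 + 1 : ℤ[X]).eval n = n ^ 2 + 1 := by
  simp [eval_add, eval_pow, eval_X, eval_one]

/-- **The swapped Type-I sum of `n² + 1`** at sifting bound `B` and level `D`: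
`Σ_{1 ≤ n ≤ x} Σ_{d ∣ s_B(n²+1), d ≤ D} μ(d) = Σ_{d ≤ D, P⁺(d) < B} μ(d) · #{1 ≤ n ≤ x : d ∣ n² + 1}`
(`stub_typeISumSwap` at `k = 1`, the `Fin 1`-tuples collapsed). [folklore] -/
theorem typeISum_X_sq_add_one_eq_sum_congrCount (B D x : ℕ) :
    ((∑ n ∈ (Icc 1 x).filter (fun n : ℕ => ∀ i, 0 < ((![(X ^ 2 + 1 : ℤ[X])]) i).eval (n : ℤ)),
        ∑ d ∈ (Fintype.piFinset fun i =>
            (smoothPart ((fun _ : Fin 1 => B) i)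
              ((((![(X ^ 2 + 1 : ℤ[X])]) i).eval (n : ℤ)).toNat)).divisors) with (∏ i, d i) ≤ D,
          ∏ i, (ArithmeticFunction.moebius (d i) : ℤ) : ℤ) : ℝ) =
      ∑ d ∈ Nat.smoothNumbersUpTo D B, (ArithmeticFunction.moebius d : ℝ) * (congrCount (x : ℝ) d : ℝ) := by
  rw [stub_typeISumSwap 1 ![(X ^ 2 + 1 : ℤ[X])] (fun _ => B) D x, Finset.sum_filter,
    sum_piFinset_fin_one]
  push_cast
  simp only [Fin.prod_univ_one, Fin.forall_fin_one, Matrix.cons_val_fin_one, eval_X_sq_add_one]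
  rw [← Finset.sum_filter]
  apply Finset.sum_congr
  · ext m
    simp only [Finset.mem_filter, Finset.mem_Icc, Nat.smoothNumbersUpTo, Finset.mem_range,
      Nat.mem_smoothNumbers']
    constructor
    · rintro ⟨⟨h1, h2⟩, -, h3⟩
      exact ⟨by omega, fun p hp hpm => h3 p (Nat.mem_primeFactors.mpr ⟨hp, hpm, by omega⟩)⟩
    · rintro ⟨h1, h3⟩
      have hm0 : m ≠ 0 := by
        rintro rfl
        exact absurd (h3 2 Nat.prime_two (dvd_zero 2)) (by
          intro h2B
          exact absurd (h3 _ (Nat.exists_infinite_primes B).choose_spec.2 (dvd_zero _))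
            (not_lt.mpr (Nat.exists_infinite_primes B).choose_spec.1))
      exact ⟨⟨Nat.pos_of_ne_zero hm0, by omega⟩, by omega,
        fun p hp => h3 p (Nat.prime_of_mem_primeFactors hp) (Nat.dvd_of_mem_primeFactors hp)⟩
  · intro m _
    congr 1
    unfold congrCount
    rw [Nat.floor_natCast]
    congr 2
    ext n
    simp only [Finset.mem_filter]
    constructor
    · rintro ⟨hn, -, h⟩
      exact ⟨hn, by exact_mod_cast h⟩
    · rintro ⟨hn, h⟩
      exact ⟨hn, by positivity, by exact_mod_cast h⟩

/-- **Main term + remainder**: `Σ_{d} μ(d)·#{n ≤ x : d ∣ n²+1} = x · Σ_d μ(d)ρ(d)/d + Σ_d μ(d) r(𝒜; d)`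
over the `B`-friable `d ≤ D`. [folklore] -/
theorem sum_congrCount_eq (B D : ℕ) (x : ℝ) :
    ∑ d ∈ Nat.smoothNumbersUpTo D B, (ArithmeticFunction.moebius d : ℝ) * (congrCount x d : ℝ) =
      x * ∑ d ∈ Nat.smoothNumbersUpTo D B, (ArithmeticFunction.moebius d : ℝ) * (rho d : ℝ) / d +
      ∑ d ∈ Nat.smoothNumbersUpTo D B, (ArithmeticFunction.moebius d : ℝ) * rem x d := by
  rw [Finset.mul_sum, ← Finset.sum_add_distrib]
  refine Finset.sum_congr rfl fun d _ => ?_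
  unfold rem
  ring

/-! ### The lever -/

/-- **The lever from a level-of-distribution statement of M2's shape.**  If
`|Σ_{d ≤ D, P⁺(d) < ⌈y⌉} μ(d) r(𝒜; d)| ≤ x^{1−1/1000}` for all large `x`, `2 ≤ y ≤ x^{1/75}`,
`1 ≤ D ≤ x^{1+1/600}`, then for Buchstab's `ω`, every `u ≥ 150` and `0 < δ ≤ 1/600`:
`typeISum_{X²+1}(u, 1+δ; x)·log x/x → (𝔖/2)·u·ω((1+δ)u/2)` (M1 supplies the main term).
[cite: IwaniecInventiones1978, Corollary p. 176] -/
theorem typeILevelPush_X_sq_add_one_of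
    (hM2 : ∀ᶠ x : ℝ in atTop, ∀ y D : ℝ, 2 ≤ y → y ≤ x ^ (1 / 75 : ℝ) → 1 ≤ D →
      D ≤ x ^ (1 + 1 / 600 : ℝ) →
      |∑ d ∈ Nat.smoothNumbersUpTo ⌊D⌋₊ ⌈y⌉₊, (ArithmeticFunction.moebius d : ℝ) * rem x d| ≤
        x ^ (1 - 1 / 1000 : ℝ)) :
    ∀ ω : ℝ → ℝ, ((∀ u : ℝ, 1 ≤ u → u ≤ 2 → ω u = u⁻¹) ∧ ContinuousOn ω (Set.Ici 1) ∧
        (∀ u : ℝ, 2 < u → HasDerivAt (fun t : ℝ => t * ω t) (ω (u - 1)) u)) →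
      ∃ u₀ : ℝ, 2 < u₀ ∧ ∀ u : ℝ, u₀ ≤ u → ∃ δ₀ : ℝ, 0 < δ₀ ∧ ∀ δ : ℝ, 0 < δ → δ ≤ δ₀ →
        Tendsto (fun x : ℕ =>
          ((∑ n ∈ (Icc 1 x).filter (fun n : ℕ => ∀ i, 0 < ((![(X ^ 2 + 1 : ℤ[X])]) i).eval (n : ℤ)),
              ∑ d ∈ (Fintype.piFinset fun i =>
                  (smoothPart (⌈(x : ℝ) ^ ((((![(X ^ 2 + 1 : ℤ[X])]) i).natDegree : ℝ) / u)⌉₊)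
                    ((((![(X ^ 2 + 1 : ℤ[X])]) i).eval (n : ℤ)).toNat)).divisors) with
                  (∏ i, d i) ≤ ⌊(x : ℝ) ^ (1 + δ)⌋₊,
                ∏ i, (ArithmeticFunction.moebius (d i) : ℤ) : ℤ) : ℝ) * Real.log x ^ 1 / x)
          atTop (𝓝 (batemanHornConst ![(X ^ 2 + 1 : ℤ[X])] /
            (∏ i, ((((![(X ^ 2 + 1 : ℤ[X])]) i).natDegree : ℝ))) * (u * ω ((1 + δ) * u / 2)))) := by
  rintro ω ⟨hinit, hcont, hdde⟩
  have hdeg2 : (X ^ 2 + 1 : ℤ[X]).natDegree = 2 := by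
    simpa using natDegree_X_pow_add_C (n := 2) (r := (1 : ℤ))
  refine ⟨150, by norm_num, fun u hu => ⟨1 / 600, by norm_num, fun δ hδ hδ₀ => ?_⟩⟩
  have hu0 : 0 < u := by linarith
  set s : ℝ := (1 + δ) * u / 2 with hs
  have hs1 : 1 < s := by rw [hs]; nlinarith
  set Cf : ℝ := batemanHornConst ![(X ^ 2 + 1 : ℤ[X])] with hCf
  have hg : IsBatemanHornSystem ![(X ^ 2 + 1 : ℤ[X])] := isBatemanHornSystem_X_sq_add_one
  -- Buchstab's ω is the tree's `buchstabOmega`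
  have hωs : ω s = buchstabOmega s :=
    IncrementAnchoring.OmegaFacts.eq_buchstabOmega hinit hcont hdde hs1.le
  -- the objects: `G x = Σ μρ/d`, `R x = Σ μ·rem` over the `⌈x^{2/u}⌉`-friable `d ≤ x^{1+δ}`
  obtain ⟨G, hG⟩ : ∃ G : ℕ → ℝ, ∀ x : ℕ, G x =
      ∑ d ∈ Nat.smoothNumbersUpTo ⌊(x : ℝ) ^ (1 + δ)⌋₊ ⌈(x : ℝ) ^ ((2 : ℝ) / u)⌉₊,
        (ArithmeticFunction.moebius d : ℝ) * (rho d : ℝ) / d := ⟨_, fun _ => rfl⟩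
  obtain ⟨R, hR⟩ : ∃ R : ℕ → ℝ, ∀ x : ℕ, R x =
      ∑ d ∈ Nat.smoothNumbersUpTo ⌊(x : ℝ) ^ (1 + δ)⌋₊ ⌈(x : ℝ) ^ ((2 : ℝ) / u)⌉₊,
        (ArithmeticFunction.moebius d : ℝ) * rem (x : ℝ) d := ⟨_, fun _ => rfl⟩
  -- Step 1: the function is `(x G + R) · log x / x`
  have hfun : (fun x : ℕ =>
      ((∑ n ∈ (Icc 1 x).filter (fun n : ℕ => ∀ i, 0 < ((![(X ^ 2 + 1 : ℤ[X])]) i).eval (n : ℤ)),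
          ∑ d ∈ (Fintype.piFinset fun i =>
              (smoothPart (⌈(x : ℝ) ^ ((((![(X ^ 2 + 1 : ℤ[X])]) i).natDegree : ℝ) / u)⌉₊)
                ((((![(X ^ 2 + 1 : ℤ[X])]) i).eval (n : ℤ)).toNat)).divisors) with
              (∏ i, d i) ≤ ⌊(x : ℝ) ^ (1 + δ)⌋₊,
            ∏ i, (ArithmeticFunction.moebius (d i) : ℤ) : ℤ) : ℝ) * Real.log x ^ 1 / x) =
      fun x : ℕ => ((x : ℝ) * G x + R x) * Real.log x / x := by
    funext x
    have h := typeISum_X_sq_add_one_eq_sum_congrCount ⌈(x : ℝ) ^ ((2 : ℝ) / u)⌉₊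
      ⌊(x : ℝ) ^ (1 + δ)⌋₊ x
    simp only [Matrix.cons_val_fin_one] at h ⊢
    rw [hdeg2, Nat.cast_ofNat, pow_one, h, sum_congrCount_eq, ← hG x, ← hR x]
  rw [hfun]
  -- Step 2: the main term `G x · log x → (u/2) · C · ω_B(s)`
  obtain ⟨C', hC'0, hM1⟩ :=
    FriableMoebiusRoot.exists_abs_friableSum_sub_buchstab_le hg hs1 s
  have h2u : 0 < 2 / u := by positivity
  -- eventually (in ℕ): `x ≥ 2` and `x^{2/u} ≥ 2`
  have hev1 : ∀ᶠ x : ℕ in atTop, (2 : ℝ) ≤ x := by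
    filter_upwards [eventually_ge_atTop 2] with x hx; exact_mod_cast hx
  have hev2 : ∀ᶠ x : ℕ in atTop, (2 : ℝ) ≤ (x : ℝ) ^ (2 / u) :=
    ((tendsto_rpow_atTop h2u).comp tendsto_natCast_atTop_atTop).eventually_ge_atTop 2
  have hGbound : ∀ᶠ x : ℕ in atTop, |G x * Real.log x - u / 2 * (Cf * buchstabOmega s)| ≤
      (u ^ 2 / 4 * C') / Real.log x := by
    filter_upwards [hev1, hev2] with x hx2 hy2
    have hx0 : (0 : ℝ) < x := by linarith
    have hx1 : (1 : ℝ) < x := by linarith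
    have hlx : 0 < Real.log x := Real.log_pos hx1
    set y : ℝ := (x : ℝ) ^ (2 / u) with hy
    set x' : ℝ := (x : ℝ) ^ (1 + δ) with hx'
    have hly : Real.log y = 2 / u * Real.log x := by rw [hy, Real.log_rpow hx0]
    have hlx' : Real.log x' = (1 + δ) * Real.log x := by rw [hx', Real.log_rpow hx0]
    have hly0 : 0 < Real.log y := by rw [hly]; positivity
    have hratio : Real.log x' = s * Real.log y := by rw [hlx', hly, hs]; field_simp
    have hyx' : y ≤ x' := by
      rw [hy, hx']
      refine Real.rpow_le_rpow_of_exponent_le hx1.le ?_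
      rw [div_le_iff₀ hu0]; nlinarith
    have h := hM1 x' y hy2 hyx' (le_of_eq hratio.symm) (le_of_eq hratio)
    have hsr : Real.log x' / Real.log y = s := by rw [hratio]; field_simp
    rw [hsr] at h
    -- `G x` is the friable Möbius–root sum at `(x', y)`
    have hGx : G x = ∑ d ∈ Nat.smoothNumbersUpTo ⌊x'⌋₊ ⌈y⌉₊,
        (ArithmeticFunction.moebius d : ℝ) * (polyRootCountMod ![(X ^ 2 + 1 : ℤ[X])] d : ℝ) / d := by
      rw [hG x]
      refine Finset.sum_congr rfl fun d _ => ?_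
      rw [rho_eq_polyRootCountMod]
    rw [← hGx] at h
    -- rescale by `log x = (u/2) log y`
    have hlogx : Real.log x = u / 2 * Real.log y := by rw [hly]; field_simp
    have hkey : G x * Real.log x - u / 2 * (Cf * buchstabOmega s) =
        u / 2 * Real.log y * (G x - Cf * buchstabOmega s / Real.log y) := by
      rw [hlogx]; field_simp
    rw [hkey, abs_mul, abs_of_pos (by positivity : 0 < u / 2 * Real.log y)]
    calc u / 2 * Real.log y * |G x - Cf * buchstabOmega s / Real.log y|
        ≤ u / 2 * Real.log y * (C' / Real.log y ^ 2) :=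
          mul_le_mul_of_nonneg_left h (by positivity)
      _ = (u ^ 2 / 4 * C') / Real.log x := by rw [hlogx]; field_simp; ring
  have hGlim : Tendsto (fun x : ℕ => G x * Real.log x) atTop (𝓝 (u / 2 * (Cf * buchstabOmega s))) := by
    have hlog : Tendsto (fun x : ℕ => (u ^ 2 / 4 * C') / Real.log x) atTop (𝓝 0) :=
      tendsto_const_nhds.div_atTop (Real.tendsto_log_atTop.comp tendsto_natCast_atTop_atTop)
    refine tendsto_sub_nhds_zero_iff.mp ?_
    exact squeeze_zero_norm' (by simpa only [Real.norm_eq_abs] using hGbound) hlog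
  -- Step 3: the remainder `R x · log x / x → 0`
  have hRbound : ∀ᶠ x : ℕ in atTop, |R x| ≤ (x : ℝ) ^ (1 - 1 / 1000 : ℝ) := by
    have hM2' := tendsto_natCast_atTop_atTop.eventually hM2
    filter_upwards [hM2', hev1, hev2] with x hx hx2 hy2
    have hx1 : (1 : ℝ) ≤ x := by linarith
    have hyle : (x : ℝ) ^ (2 / u) ≤ (x : ℝ) ^ (1 / 75 : ℝ) := by
      refine Real.rpow_le_rpow_of_exponent_le hx1 ?_
      rw [div_le_iff₀ hu0]; linarith
    have hD1 : (1 : ℝ) ≤ (x : ℝ) ^ (1 + δ) := Real.one_le_rpow hx1 (by linarith)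
    have hDle : (x : ℝ) ^ (1 + δ) ≤ (x : ℝ) ^ (1 + 1 / 600 : ℝ) :=
      Real.rpow_le_rpow_of_exponent_le hx1 (by linarith)
    rw [hR x]
    exact hx _ _ hy2 hyle hD1 hDle
  have hRlim : Tendsto (fun x : ℕ => R x * Real.log x / x) atTop (𝓝 0) := by
    have hlo := (isLittleO_log_rpow_atTop (show (0 : ℝ) < 1 / 1000 by norm_num)).tendsto_div_nhds_zero
    have hlo' : Tendsto (fun x : ℕ => Real.log x / (x : ℝ) ^ (1 / 1000 : ℝ)) atTop (𝓝 0) :=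
      hlo.comp tendsto_natCast_atTop_atTop
    refine squeeze_zero_norm' ?_ hlo'
    filter_upwards [hRbound, hev1] with x hRx hx2
    have hx0 : (0 : ℝ) < x := by linarith
    have hlx : 0 ≤ Real.log x := Real.log_nonneg (by linarith)
    rw [Real.norm_eq_abs, abs_div, abs_mul, abs_of_nonneg hlx, abs_of_pos hx0]
    have hsplit : (x : ℝ) ^ (1 - 1 / 1000 : ℝ) = x / (x : ℝ) ^ (1 / 1000 : ℝ) := by
      rw [Real.rpow_sub hx0, Real.rpow_one]
    calc |R x| * Real.log x / x ≤ (x : ℝ) ^ (1 - 1 / 1000 : ℝ) * Real.log x / x := by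
          gcongr
      _ = Real.log x / (x : ℝ) ^ (1 / 1000 : ℝ) := by
          rw [hsplit]; field_simp
  -- Step 4: combine
  have hlim : Tendsto (fun x : ℕ => G x * Real.log x + R x * Real.log x / x) atTop
      (𝓝 (u / 2 * (Cf * buchstabOmega s) + 0)) := hGlim.add hRlim
  rw [add_zero] at hlim
  have hval : u / 2 * (Cf * buchstabOmega s) =
      batemanHornConst ![(X ^ 2 + 1 : ℤ[X])] /
        (∏ i, ((((![(X ^ 2 + 1 : ℤ[X])]) i).natDegree : ℝ))) * (u * ω ((1 + δ) * u / 2)) := by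
    rw [Fin.prod_univ_one, Matrix.cons_val_fin_one, hdeg2, ← hs, hωs, hCf]
    push_cast; ring
  rw [← hval]
  refine hlim.congr' ?_
  filter_upwards [hev1] with x hx2
  have hx0 : (x : ℝ) ≠ 0 := by positivity
  field_simp

/-- **THE LEVER (S4-slice of line `friable-deep-tail`), PROVED**: for Buchstab's `ω` (inline predicate)
there is `u₀ > 2` (`= 150`) such that for every `u ≥ u₀` and `0 < δ ≤ δ₀ = 1/600` the n-wise Type-I
part of `Φ_{X²+1}(x, u)` at level `x^{1+δ}` — `Σ_{1 ≤ n ≤ x} Σ_{d ∣ s(n), d ≤ x^{1+δ}} μ(d)`, `s(n)` the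
`⌈x^{2/u}⌉`-friable part of `n² + 1` — satisfies `typeISum·log x/x → (𝔖/2)·u·ω((1+δ)u/2)`,
`𝔖 = batemanHornConst ![X²+1]`.  This is `TypeILevelPushAt (X ^ 2 + 1)` of the checked skeleton,
unfolded; inputs: M1 (`FriableMoebiusRoot.exists_abs_friableSum_sub_buchstab_le`), M2
(`Iwaniec1978.abs_sum_friable_moebius_rem_le_rpow`), the swap S2a (`stub_typeISumSwap`) and
`OmegaFacts.eq_buchstabOmega`. [cite: IwaniecInventiones1978, Corollary p. 176] -/
theorem typeILevelPush_X_sq_add_one :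
    ∀ ω : ℝ → ℝ, ((∀ u : ℝ, 1 ≤ u → u ≤ 2 → ω u = u⁻¹) ∧ ContinuousOn ω (Set.Ici 1) ∧
        (∀ u : ℝ, 2 < u → HasDerivAt (fun t : ℝ => t * ω t) (ω (u - 1)) u)) →
      ∃ u₀ : ℝ, 2 < u₀ ∧ ∀ u : ℝ, u₀ ≤ u → ∃ δ₀ : ℝ, 0 < δ₀ ∧ ∀ δ : ℝ, 0 < δ → δ ≤ δ₀ →
        Tendsto (fun x : ℕ =>
          ((∑ n ∈ (Icc 1 x).filter (fun n : ℕ => ∀ i, 0 < ((![(X ^ 2 + 1 : ℤ[X])]) i).eval (n : ℤ)),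
              ∑ d ∈ (Fintype.piFinset fun i =>
                  (smoothPart (⌈(x : ℝ) ^ ((((![(X ^ 2 + 1 : ℤ[X])]) i).natDegree : ℝ) / u)⌉₊)
                    ((((![(X ^ 2 + 1 : ℤ[X])]) i).eval (n : ℤ)).toNat)).divisors) with
                  (∏ i, d i) ≤ ⌊(x : ℝ) ^ (1 + δ)⌋₊,
                ∏ i, (ArithmeticFunction.moebius (d i) : ℤ) : ℤ) : ℝ) * Real.log x ^ 1 / x)
          atTop (𝓝 (batemanHornConst ![(X ^ 2 + 1 : ℤ[X])] /
            (∏ i, ((((![(X ^ 2 + 1 : ℤ[X])]) i).natDegree : ℝ))) * (u * ω ((1 + δ) * u / 2)))) :=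
  typeILevelPush_X_sq_add_one_of Literature.NumberTheory.Sieve.Iwaniec1978.abs_sum_friable_moebius_rem_le_rpow

end Summit.Parity.BatemanHorn.Cruxes.RoughValueLaw.FriableDeepTail

end
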